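import Summits.BirchSwinnertonDyer.Rank1Residual.Additive.TameBranchRigidityDescent
import Summits.BirchSwinnertonDyer.Rank1Residual.Additive.PowerMapRigidity
import Summits.BirchSwinnertonDyer.Rank1Residual.Additive.PowerSeriesSubstEval
import Summits.BirchSwinnertonDyer.Rank1Residual.Additive.TameBranchUnique
import HarnessLib

/-!
# Class N10, tame branch: the FUNCTIONAL EQUATION `α·B·B'((1+T)^p−1) = α'·B'·B((1+T)^p−1)` of two
# witnesses of `IsTameBranchOf` (cell `b2b-bsdres`, sub-cell additive-p2, gen 21; file 2 of 3 of the
# TUPLE RIGIDITY of the E-normalised tame branch — `TameBranchRigidityDescent.lean`, this file,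
# `TameBranchRigidity.lean`)

HONEST FRAMING (cell `b2b-bsdres`, run/shared/lean/b2b/bsd-rank1-residual/, verbatim in every
file): the goal of the cell is to DELETE the COMBINATION-SHAPED residual classes of the
Birch–Swinnerton-Dyer formula for ALL analytic-rank `≤ 1` elliptic curves over `ℚ` — "full BSD
formula for every rank `≤ 1` curve in class `C`" assembled STRICTLY from published theorems — so
that the rank-`≤ 1` remainder becomes exactly the CONSTRUCTION-SHAPED classes, which are TYPED
(missing-input `Prop`s), NOT attempted. This is not "finishing BSD". Research route on the
CONSTRUCTION-SHAPED classes X3♯(G-ord)/X4♯(G-ord) (sub-cell additive-p2, gen 21); THEOREMS ONLY —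
no definition, no named fact, no conjecture node; labels / RESIDUAL-MAP marks UNCHANGED; nothing
booked.

## What and why

`IsTameBranchOf f p ε α B` (`TameBranchLower.lean` §1, cc-typer-2) types the E-normalised tame
branch by interpolation: `B ∈ ℚ_p⟦T⟧` bounded, `B(0) = α⁻¹[0]⁺_f`,
`B(κ(γ)−1) = α^{−m} p^{−1} τ(ε,ψ_κ) ∑_b κ(b)[b/p^m]⁺_f` for every character `κ` of `Γ` of conductor
`p^m`, `m ≥ 2`. `TameBranchUnique.lean` (cc-typer-2 GEN 3) proved uniqueness of `B` GIVEN `(ε, α)`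
and recorded as NOT proved the dependence on the unit `α` and on `ε` versus `ε̄` (A227 flag
`Del02-ThmC-tuple-robustness`). This file supplies the analytic half of the tuple rigidity:

* §1 values: an element of `Λ ⊗ ℚ_p` has bounded coefficients; the points `κ(γ) − 1` lie in the
  open disc; the power map `(1+T)^p − 1` has integral coefficients and value `(1+z)^p − 1`; and
  **a non-zero `B ∈ Λ ⊗ ℚ_p` vanishes at NO character of some large conductor**
  (`exists_level_forall_not_hasSum_zero`: finitely many zeros in the open disc,
  `MemIwasawaRat.finite_setOf_hasSum_zero`, distinct conductors give distinct points).
* §2 `IsTameBranchOf.alpha_ne_zero` (a non-zero witness has `α ≠ 0`: for `α = 0` all prescribed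
  values vanish) and `IsTameBranchOf.ne_zero_of_ne_zero` (if ONE tuple has a non-zero witness, every
  tuple with `α' ≠ 0` has: the twisted symbol sums `∑_b κ(b)[b/p^m]⁺_f` are shared and
  `τ(ε',ψ_κ) ≠ 0`).
* §3 **`IsTameBranchOf.mul_subst_eq`** — for `p` odd, two witnesses `(ε,α,B)`, `(ε',α',B')` with
  `α, α' ≠ 0` satisfy `α·B·B'((1+T)^p−1) = α'·B'·B((1+T)^p−1)` in `ℚ_p⟦T⟧`: the bounded series
  `F = α B (B'∘φ) − α' B' (B∘φ)` vanishes at `κ(γ)−1` for every `κ` of conductor `p^{m+1} ≥ p³`,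
  because `B∘φ` takes there the value of `B` at `κ₁(γ)−1 = (1 + (κ(γ)−1))^p − 1`, `κ₁` the `p`-th
  power DESCENT of `κ` (`exists_pow_prime_descent`: conductor `p^m`, SAME intrinsic Gauss sums),
  evaluation commuting with substitution (`hasSum_map_coeff_subst_mul_pow`) and being
  multiplicative (`tsum_map_coeff_mul_mul_pow`), and
  `α·α^{−m−1}·α'^{−m} = α'·α'^{−m−1}·α^{−m}`; so `F = 0` (`MemIwasawaRat.eq_zero_of_forall_hasSum_zero`).
  The rigidity of this functional equation (`PowerMapRigidity.lean`) is exploited in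
  `TameBranchRigidity.lean`.

References: Delbourgo, J. Number Theory 95 (2002) Thm (C) [Delbourgo2002];
Mazur–Tate–Teitelbaum, Invent. Math. 84 (1986) §I.11–I.14 [MazurTateTeitelbaum1986Invent];
Washington, GTM 83, §7 [Washington1997].
-/

noncomputable section

open scoped Classical MatrixGroups ModularForm

open CongruenceSubgroup

namespace Summit.BirchSwinnertonDyer.Rank1Residual.Additive

open Literature.NumberTheory.EllipticCurves Literature.NumberTheory.EllipticCurves.ModularForms
  _root_.PowerSeries

/-! ### §1 Values: bookkeeping -/

section Values

variable {p : ℕ} [hp : Fact p.Prime]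

/-- An element of `Λ ⊗ ℚ_p` has bounded coefficients (`p^n B = ι G`, `‖[T^k]G‖ ≤ 1`). [folklore] -/
theorem exists_norm_coeff_le_of_memIwasawaRat {B : PowerSeries ℚ_[p]} (hB : MemIwasawaRat p B) :
    ∃ C : ℝ, ∀ k : ℕ, ‖coeff k B‖ ≤ C := by
  obtain ⟨n, G, hG⟩ := hB
  have hp0 : (p : ℚ_[p]) ≠ 0 := Nat.cast_ne_zero.mpr hp.out.ne_zero
  refine ⟨(p : ℝ) ^ n, fun k ↦ ?_⟩
  have hk := congr_arg (coeff k) hG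
  rw [coeff_C_mul, iwasawaToPowerSeries, coeff_map] at hk
  have hnorm : ‖(p : ℚ_[p]) ^ n * coeff k B‖ ≤ 1 := by
    rw [hk]; exact PadicInt.norm_le_one _
  rw [norm_mul, norm_pow, Padic.norm_p, inv_pow] at hnorm
  have hpos : (0 : ℝ) < (p : ℝ) ^ n := pow_pos (by exact_mod_cast hp.out.pos) n
  calc ‖coeff k B‖ = (p : ℝ) ^ n * (((p : ℝ) ^ n)⁻¹ * ‖coeff k B‖) := by
        rw [← mul_assoc, mul_inv_cancel₀ hpos.ne', one_mul]
    _ ≤ (p : ℝ) ^ n * 1 := mul_le_mul_of_nonneg_left hnorm hpos.le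
    _ = (p : ℝ) ^ n := mul_one _

/-- Bounded coefficients stay bounded along `ℚ_p → ℂ_p`. [folklore] -/
theorem forall_norm_algebraMap_coeff_le_of_memIwasawaRat {B : PowerSeries ℚ_[p]}
    (hB : MemIwasawaRat p B) :
    ∃ C : ℝ, ∀ k : ℕ, ‖algebraMap ℚ_[p] ℂ_[p] (coeff k B)‖ ≤ C := by
  obtain ⟨C, hC⟩ := exists_norm_coeff_le_of_memIwasawaRat hB
  exact ⟨C, fun k ↦ by rw [norm_algebraMap']; exact hC k⟩

/-- The points `κ(γ) − 1` lie in the open unit disc. [folklore] -/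
theorem norm_apply_cyclotomicGenerator_sub_one_lt {m : ℕ} (κ : DirichletCharacter ℂ_[p] (p ^ m))
    (hord : ∃ j : ℕ, orderOf κ = p ^ j) :
    ‖κ (cyclotomicGenerator p : ZMod (p ^ m)) - 1‖ < 1 := by
  obtain ⟨j, hj⟩ := hord
  obtain ⟨v, hv⟩ := isUnit_cyclotomicGenerator_cast p m
  refine norm_sub_one_lt_one_of_pow_prime_pow_eq_one (j := j) ?_
  rw [← hv, ← MulChar.pow_apply_coe, ← hj, pow_orderOf_eq_one, MulChar.one_apply_coe]

/-- The coefficients of the power map `(1+T)^p − 1 ∈ ℚ_p⟦T⟧` are `p`-adic integers. [folklore] -/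
theorem norm_algebraMap_coeff_one_add_X_pow_sub_one_le (k : ℕ) :
    ‖algebraMap ℚ_[p] ℂ_[p] (coeff k ((1 + X : PowerSeries ℚ_[p]) ^ p - 1))‖ ≤ 1 := by
  rw [← iwasawaToPowerSeries_one_add_X_pow_sub_one, iwasawaToPowerSeries, coeff_map]
  exact norm_algebraMap_coeff_le_one _ k

/-- The power map evaluated at `z`: `∑_k ι([T^k]((1+T)^p−1)) z^k = (1+z)^p − 1`. [folklore] -/
theorem hasSum_coeff_one_add_X_pow_sub_one_mul_pow (z : ℂ_[p]) :
    HasSum (fun k ↦ algebraMap ℚ_[p] ℂ_[p] (coeff k ((1 + X : PowerSeries ℚ_[p]) ^ p - 1)) * z ^ k)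
      ((1 + z) ^ p - 1) := by
  have h := hasSum_map_coeff_coe_mul_pow (algebraMap ℚ_[p] ℂ_[p])
    ((1 + Polynomial.X : Polynomial ℚ_[p]) ^ p - 1) z
  rw [Polynomial.eval₂_sub, Polynomial.eval₂_pow, Polynomial.eval₂_add, Polynomial.eval₂_one,
    Polynomial.eval₂_X, coe_one_add_X_pow_sub_one] at h
  exact h

/-- **A series `B` with a zero set: at some large conductor `p^{k+3}`, `k ≥ m₀`, `B ≠ 0` vanishes
at NO character of `Γ`** (finitely many zeros in the open disc,
`MemIwasawaRat.finite_setOf_hasSum_zero`; distinct conductors give distinct points,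
`orderOf_apply_cyclotomicGenerator`). [folklore] -/
theorem exists_level_forall_not_hasSum_zero {B : PowerSeries ℚ_[p]} (hB : MemIwasawaRat p B)
    (hB0 : B ≠ 0) (m₀ : ℕ) :
    ∃ k : ℕ, m₀ ≤ k ∧ ∀ κ : DirichletCharacter ℂ_[p] (p ^ (k + 3)), κ.IsPrimitive → κ.Even →
      (∃ j : ℕ, orderOf κ = p ^ j) →
      ¬ HasSum (fun i ↦ algebraMap ℚ_[p] ℂ_[p] (coeff i B) *
          (κ (cyclotomicGenerator p : ZMod (p ^ (k + 3))) - 1) ^ i) 0 := by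
  by_contra hall
  push Not at hall
  have hex : ∀ k : ℕ, ∃ κ : DirichletCharacter ℂ_[p] (p ^ ((m₀ + k) + 3)),
      κ.IsPrimitive ∧ κ.Even ∧ (∃ j : ℕ, orderOf κ = p ^ j) ∧
      HasSum (fun i ↦ algebraMap ℚ_[p] ℂ_[p] (coeff i B) *
        (κ (cyclotomicGenerator p : ZMod (p ^ ((m₀ + k) + 3))) - 1) ^ i) 0 :=
    fun k ↦ hall (m₀ + k) (Nat.le_add_right _ _)
  choose κ hκ using hex
  have he : cyclotomicExponent p ≤ 2 := by unfold cyclotomicExponent; split_ifs <;> omega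
  have hmem : ∀ k : ℕ, (κ k (cyclotomicGenerator p : ZMod (p ^ ((m₀ + k) + 3))) - 1) ∈
      {z : ℂ_[p] | ‖z‖ < 1 ∧
        HasSum (fun i ↦ algebraMap ℚ_[p] ℂ_[p] (coeff i B) * z ^ i) 0} := fun k ↦
    ⟨norm_apply_cyclotomicGenerator_sub_one_lt _ (hκ k).2.2.1, (hκ k).2.2.2⟩
  have hinj : Function.Injective fun k : ℕ ↦
      κ k (cyclotomicGenerator p : ZMod (p ^ ((m₀ + k) + 3))) - 1 := by
    intro k k' hkk'
    have heq := sub_left_injective hkk'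
    have ho := congr_arg orderOf heq
    rw [orderOf_apply_cyclotomicGenerator (by omega) (κ k) (hκ k).1 (hκ k).2.1 (hκ k).2.2.1,
      orderOf_apply_cyclotomicGenerator (by omega) (κ k') (hκ k').1 (hκ k').2.1 (hκ k').2.2.1]
      at ho
    have := Nat.pow_right_injective hp.out.two_le ho
    omega
  exact (Set.infinite_of_injective_forall_mem hinj hmem)
    (MemIwasawaRat.finite_setOf_hasSum_zero hB hB0)

end Values

/-! ### §2 First consequences of the package: `α ≠ 0`, non-vanishing transfers -/

section Package

variable {p : ℕ} [hp : Fact p.Prime] {N : ℕ} {f : CuspForm (Gamma0 N) 2}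
  {ε ε' : DirichletCharacter ℂ_[p] p} {α α' : ℚ_[p]} {B B' : PowerSeries ℚ_[p]}

/-- A witness of the package lies in `Λ ⊗ ℚ_p`. [folklore] -/
theorem IsTameBranchOf.memIwasawaRat (h : IsTameBranchOf f p ε α B) : MemIwasawaRat p B := by
  obtain ⟨C, hC⟩ := h.bounded
  exact memIwasawaRat_of_forall_norm_coeff_le hC

/-- **A non-zero witness has `α ≠ 0`**: for `α = 0` every prescribed value (`α⁻¹ = 0`) and the
constant term vanish, so `B = 0` by the uniqueness principle. [folklore] -/
theorem IsTameBranchOf.alpha_ne_zero (h : IsTameBranchOf f p ε α B) (hB : B ≠ 0) : α ≠ 0 := by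
  intro hα
  apply hB
  obtain ⟨C, hC⟩ := h.bounded
  refine eq_zero_of_bounded_of_forall_character_hasSum_zero (algebraMap ℚ_[p] ℂ_[p])
    (algebraMap ℚ_[p] ℂ_[p]).injective (C := C) (fun i ↦ by rw [norm_algebraMap']; exact hC i)
    ?_ ?_
  · rw [h.constantCoeff, hα, inv_zero, zero_mul]
  · intro m hm κ hκ heven hord
    rcases Nat.lt_or_ge m 2 with hm2 | hm2
    · obtain rfl : m = 1 := by omega
      exact absurd hκ (not_isPrimitive_of_orderOf_eq_pow_level_one hord)
    · have hs := h.2.2 m hm2 κ hκ heven hord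
      rwa [hα, inv_zero, zero_pow (by omega), zero_mul, map_zero, zero_mul, zero_mul] at hs

/-- The prescribed value at `κ` of a witness, as a `tsum`. [folklore] -/
theorem IsTameBranchOf.tsum_eq (h : IsTameBranchOf f p ε α B) {m : ℕ} (hm : 2 ≤ m)
    (κ : DirichletCharacter ℂ_[p] (p ^ m)) (hκ : κ.IsPrimitive) (heven : κ.Even)
    (hord : ∃ j : ℕ, orderOf κ = p ^ j) :
    ∑' i, algebraMap ℚ_[p] ℂ_[p] (coeff i B) * (κ (cyclotomicGenerator p : ZMod (p ^ m)) - 1) ^ i =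
      algebraMap ℚ_[p] ℂ_[p] (α⁻¹ ^ m * (p : ℚ_[p])⁻¹) * tameGaussSum p ε κ *
        ratTwistedSymbolSum f κ :=
  (h.2.2 m hm κ hκ heven hord).tsum_eq

/-- **Non-vanishing transfers between tuples**: if `(ε, α, B)` has `B ≠ 0` and `(ε', α', B')` is a
witness with `α' ≠ 0`, then `B' ≠ 0` — otherwise all twisted symbol sums `∑_b κ(b)[b/p^m]⁺_f`,
`m ≥ 2`, vanish (`α'^{−m} p^{−1} τ(ε',ψ_κ) ≠ 0`), so `B` vanishes at every character of conductor
`≥ p³` and `B = 0`. [folklore] -/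
theorem IsTameBranchOf.ne_zero_of_ne_zero (h : IsTameBranchOf f p ε α B)
    (h' : IsTameBranchOf f p ε' α' B') (hB : B ≠ 0) (hα' : α' ≠ 0) : B' ≠ 0 := by
  intro hB'
  apply hB
  refine MemIwasawaRat.eq_zero_of_forall_hasSum_zero h.memIwasawaRat fun k κ hκ heven hord ↦ ?_
  have hp0 : (p : ℚ_[p]) ≠ 0 := Nat.cast_ne_zero.mpr hp.out.ne_zero
  -- the twisted symbol sum vanishes
  have hS : ratTwistedSymbolSum f κ = 0 := by
    have hs' := h'.2.2 (k + 3) (by omega) κ hκ heven hord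
    have hzero : HasSum (fun i : ℕ ↦ algebraMap ℚ_[p] ℂ_[p] (coeff i B') *
        (κ (cyclotomicGenerator p : ZMod (p ^ (k + 3))) - 1) ^ i) 0 := by
      have hfun : (fun i : ℕ ↦ algebraMap ℚ_[p] ℂ_[p] (coeff i B') *
          (κ (cyclotomicGenerator p : ZMod (p ^ (k + 3))) - 1) ^ i) = fun _ ↦ 0 := by
        funext i
        rw [hB', map_zero, map_zero, zero_mul]
      rw [hfun]
      exact hasSum_zero
    have hval := hs'.unique hzero
    have hc : algebraMap ℚ_[p] ℂ_[p] (α'⁻¹ ^ (k + 3) * (p : ℚ_[p])⁻¹) *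
        tameGaussSum p ε' κ ≠ 0 :=
      mul_ne_zero (by
        rw [Ne, map_eq_zero_iff _ (algebraMap ℚ_[p] ℂ_[p]).injective]
        exact mul_ne_zero (pow_ne_zero _ (inv_ne_zero hα')) (inv_ne_zero hp0))
        (tameGaussSum_ne_zero (by omega) hκ ε')
    rcases mul_eq_zero.mp hval with h1 | h1
    · exact absurd h1 hc
    · exact h1
  have hs := h.2.2 (k + 3) (by omega) κ hκ heven hord
  rwa [hS, mul_zero] at hs

end Package

/-! ### §3 The functional equation `α·B·B'((1+T)^p−1) = α'·B'·B((1+T)^p−1)` -/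

section FunctionalEquation

variable {p : ℕ} [hp : Fact p.Prime] {N : ℕ} {f : CuspForm (Gamma0 N) 2}
  {ε ε' : DirichletCharacter ℂ_[p] p} {α α' : ℚ_[p]} {B B' : PowerSeries ℚ_[p]}

/-- **The functional equation of two witnesses.** For `p` odd and two tuples `(ε, α, B)`,
`(ε', α', B')` of the package with `α, α' ≠ 0`:
`α · B · B'((1+T)^p − 1) = α' · B' · B((1+T)^p − 1)` in `ℚ_p⟦T⟧`. Both sides are bounded; at
`z = κ(γ) − 1`, `κ` a character of `Γ` of conductor `p^{m+1} ≥ p³`, the composite `B((1+T)^p−1)`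
takes the value of `B` at `(1+z)^p − 1 = κ₁(γ) − 1` for the `p`-th power descent `κ₁` of `κ`
(conductor `p^m`, SAME Gauss sums `τ(·,ψ_{κ₁}) = τ(·,ψ_κ)`), so the value of the difference is
`[α·α^{−m−1}·α'^{−m} − α'·α'^{−m−1}·α^{−m}] p^{−2} τ(ε,ψ_κ)τ(ε',ψ_κ) S(κ)S(κ₁) = 0`; a bounded
series vanishing at all characters of conductor `≥ p³` is `0`. [folklore] -/
theorem IsTameBranchOf.mul_subst_eq (hp2 : p ≠ 2) (h : IsTameBranchOf f p ε α B)
    (h' : IsTameBranchOf f p ε' α' B') (hα : α ≠ 0) (hα' : α' ≠ 0) :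
    C α * B * B'.subst ((1 + X : PowerSeries ℚ_[p]) ^ p - 1) =
      C α' * B' * B.subst ((1 + X : PowerSeries ℚ_[p]) ^ p - 1) := by
  set ι := algebraMap ℚ_[p] ℂ_[p] with hι
  set φ : PowerSeries ℚ_[p] := (1 + X : PowerSeries ℚ_[p]) ^ p - 1 with hφ
  have hp0 : (p : ℚ_[p]) ≠ 0 := Nat.cast_ne_zero.mpr hp.out.ne_zero
  have hφ0 : PowerSeries.constantCoeff φ = 0 := constantCoeff_one_add_X_pow_sub_one p
  -- boundedness
  have hBm := h.memIwasawaRat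
  have hB'm := h'.memIwasawaRat
  obtain ⟨CB, hCB⟩ := forall_norm_algebraMap_coeff_le_of_memIwasawaRat hBm
  obtain ⟨CB', hCB'⟩ := forall_norm_algebraMap_coeff_le_of_memIwasawaRat hB'm
  obtain ⟨CS, hCS⟩ := forall_norm_algebraMap_coeff_le_of_memIwasawaRat
    (memIwasawaRat_subst_one_add_X_pow_sub_one hBm p)
  obtain ⟨CS', hCS'⟩ := forall_norm_algebraMap_coeff_le_of_memIwasawaRat
    (memIwasawaRat_subst_one_add_X_pow_sub_one hB'm p)
  have hL : MemIwasawaRat p (C α * B * B'.subst φ) :=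
    memIwasawaRat_mul (memIwasawaRat_C_mul hBm α) (memIwasawaRat_subst_one_add_X_pow_sub_one hB'm p)
  have hR : MemIwasawaRat p (C α' * B' * B.subst φ) :=
    memIwasawaRat_mul (memIwasawaRat_C_mul hB'm α') (memIwasawaRat_subst_one_add_X_pow_sub_one hBm p)
  obtain ⟨CL, hCL⟩ := forall_norm_algebraMap_coeff_le_of_memIwasawaRat hL
  obtain ⟨CR, hCR⟩ := forall_norm_algebraMap_coeff_le_of_memIwasawaRat hR
  rw [← sub_eq_zero]
  refine MemIwasawaRat.eq_zero_of_forall_hasSum_zero (hL.sub hR) fun k κ hκ heven hord ↦ ?_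
  -- the point `z`, the descent `κ₁` and its point `w = (1+z)^p - 1`
  set z : ℂ_[p] := κ (cyclotomicGenerator p : ZMod (p ^ (k + 3))) - 1 with hz
  have hz1 : ‖z‖ < 1 := norm_apply_cyclotomicGenerator_sub_one_lt κ hord
  obtain ⟨κ₁, hκ₁, heven₁, hord₁, hγ₁, hwild₁⟩ :=
    exists_pow_prime_descent hp2 (by omega : 2 ≤ k + 2) κ hκ heven hord
  set w : ℂ_[p] := κ₁ (cyclotomicGenerator p : ZMod (p ^ (k + 2))) - 1 with hw
  have hwz : w = (1 + z) ^ p - 1 := by rw [hw, hz, hγ₁, add_sub_cancel]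
  have hτ : tameGaussSum p ε κ₁ = tameGaussSum p ε κ :=
    tameGaussSum_eq_of_wildAddChar_eq (by omega) (by omega) hwild₁ ε
  have hτ' : tameGaussSum p ε' κ₁ = tameGaussSum p ε' κ :=
    tameGaussSum_eq_of_wildAddChar_eq (by omega) (by omega) hwild₁ ε'
  -- the value of `φ` at `z` is `w`
  have hφz : HasSum (fun i ↦ ι (coeff i φ) * z ^ i) w := by
    rw [hwz]; exact hasSum_coeff_one_add_X_pow_sub_one_mul_pow z
  -- values of `B`, `B'` at `z` and at `w`
  have vBz := h.tsum_eq (by omega : 2 ≤ k + 3) κ hκ heven hord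
  have vB'z := h'.tsum_eq (by omega : 2 ≤ k + 3) κ hκ heven hord
  have vBw := h.tsum_eq (by omega : 2 ≤ k + 2) κ₁ hκ₁ heven₁ hord₁
  have vB'w := h'.tsum_eq (by omega : 2 ≤ k + 2) κ₁ hκ₁ heven₁ hord₁
  -- values of the composites at `z`
  have vSz : ∑' i, ι (coeff i (B.subst φ)) * z ^ i = ∑' i, ι (coeff i B) * w ^ i :=
    (hasSum_map_coeff_subst_mul_pow ι (hA := hCB) norm_algebraMap_coeff_one_add_X_pow_sub_one_le
      hφ0 hz1 hφz).tsum_eq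
  have vS'z : ∑' i, ι (coeff i (B'.subst φ)) * z ^ i = ∑' i, ι (coeff i B') * w ^ i :=
    (hasSum_map_coeff_subst_mul_pow ι (hA := hCB') norm_algebraMap_coeff_one_add_X_pow_sub_one_le
      hφ0 hz1 hφz).tsum_eq
  -- the value of each side
  have vL : ∑' i, ι (coeff i (C α * B * B'.subst φ)) * z ^ i =
      ι α * ((∑' i, ι (coeff i B) * z ^ i) * ∑' i, ι (coeff i (B'.subst φ)) * z ^ i) := by
    rw [mul_assoc, ← tsum_map_coeff_mul_mul_pow ι hCB hCS' hz1, ← tsum_mul_left]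
    refine tsum_congr fun i ↦ ?_
    rw [coeff_C_mul, map_mul, mul_assoc]
  have vR : ∑' i, ι (coeff i (C α' * B' * B.subst φ)) * z ^ i =
      ι α' * ((∑' i, ι (coeff i B') * z ^ i) * ∑' i, ι (coeff i (B.subst φ)) * z ^ i) := by
    rw [mul_assoc, ← tsum_map_coeff_mul_mul_pow ι hCB' hCS hz1, ← tsum_mul_left]
    refine tsum_congr fun i ↦ ?_
    rw [coeff_C_mul, map_mul, mul_assoc]
  -- the scalar identity
  have e1 : α * α⁻¹ ^ (k + 3) = α⁻¹ ^ (k + 2) := by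
    rw [pow_succ, mul_left_comm, mul_inv_cancel₀ hα, mul_one]
  have e2 : α' * α'⁻¹ ^ (k + 3) = α'⁻¹ ^ (k + 2) := by
    rw [pow_succ, mul_left_comm, mul_inv_cancel₀ hα', mul_one]
  have hsc : α * (α⁻¹ ^ (k + 3) * (p : ℚ_[p])⁻¹) * (α'⁻¹ ^ (k + 2) * (p : ℚ_[p])⁻¹) =
      α' * (α'⁻¹ ^ (k + 3) * (p : ℚ_[p])⁻¹) * (α⁻¹ ^ (k + 2) * (p : ℚ_[p])⁻¹) := by
    linear_combination (α'⁻¹ ^ (k + 2) * (p : ℚ_[p])⁻¹ * (p : ℚ_[p])⁻¹) * e1 -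
      (α⁻¹ ^ (k + 2) * (p : ℚ_[p])⁻¹ * (p : ℚ_[p])⁻¹) * e2
  -- assemble
  have hsum : Summable fun i ↦ ι (coeff i (C α * B * B'.subst φ - C α' * B' * B.subst φ)) * z ^ i :=
    summable_map_coeff_mul_pow ι (C := CL + CR) (fun i ↦ by
      rw [map_sub, map_sub]
      exact (norm_sub_le _ _).trans (add_le_add (hCL i) (hCR i))) hz1
  have htsum : ∑' i, ι (coeff i (C α * B * B'.subst φ - C α' * B' * B.subst φ)) * z ^ i = 0 := by
    have hsplit : (fun i ↦ ι (coeff i (C α * B * B'.subst φ - C α' * B' * B.subst φ)) * z ^ i) =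
        fun i ↦ ι (coeff i (C α * B * B'.subst φ)) * z ^ i -
          ι (coeff i (C α' * B' * B.subst φ)) * z ^ i := by
      funext i; rw [map_sub, map_sub, sub_mul]
    rw [hsplit, Summable.tsum_sub (summable_map_coeff_mul_pow ι hCL hz1)
      (summable_map_coeff_mul_pow ι hCR hz1),
      vL, vR, vSz, vS'z, vBz, vB'z, vBw, vB'w, hτ, hτ', sub_eq_zero]
    have key : ι α * (ι (α⁻¹ ^ (k + 3) * (p : ℚ_[p])⁻¹)) * (ι (α'⁻¹ ^ (k + 2) * (p : ℚ_[p])⁻¹)) =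
        ι α' * (ι (α'⁻¹ ^ (k + 3) * (p : ℚ_[p])⁻¹)) * (ι (α⁻¹ ^ (k + 2) * (p : ℚ_[p])⁻¹)) := by
      rw [← map_mul, ← map_mul, ← map_mul, ← map_mul, hsc]
    linear_combination (tameGaussSum p ε κ * ratTwistedSymbolSum f κ *
      (tameGaussSum p ε' κ * ratTwistedSymbolSum f κ₁)) * key
  rw [← htsum]
  exact hsum.hasSum

end FunctionalEquation

end Summit.BirchSwinnertonDyer.Rank1Residual.Additive

end
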